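import Literature.Analysis.FluidPDE.OseenKernelBlocks
import Literature.Analysis.FluidPDE.KatoPicardLp
import Literature.Analysis.FluidPDE.KochTataruSymbol
import HarnessLib

/-!
# Littlewood–Paley blocks of the Oseen slices `T_σ[v, w] = ∫ K(σ, ·-y)[v(y), w(y)] dy`

Analysis/FluidPDE proof file (no definitions, no named facts). Second layer (after the kernel
bounds of `OseenKernelBlocks.lean`) of the Besov regularity of the Navier–Stokes Duhamel term
`B(u,u)(t) = ∫₀ᵗ T_{t-s}[u(s), u(s)] ds` of a Kato-class field (item "Duhamel term in
`C((0,T); Ḃ^{-1+3/p}_{p,1})`" of `Literature.Analysis.FluidPDE.exists_isBesovMildSolutionOn`,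
Bahouri–Chemin–Danchin 2011, Thm. 5.40; Gallagher–Koch–Planchon 2016, App. B). For the slices
`T_σ[v, w](x) = ∫ K(σ, x - y)[v(y), w(y)] dy` (`K = oseenKernel`, the kernel of `e^{σΔ}ℙ∇·`) with
`v ∈ L^p ∩` measurable, `w ∈ L^∞`, `1 < p`, this file proves:

* `integral_smul_integral_oseenKernel_comm` — **Fubini for an `L¹` kernel against a slice**:
  `∫ k(t) ∫ K(σ, x-t-y)[v(y), w(y)] dy dt = ∫ (∫ k(t) K(σ, x-y-t)[v(y), w(y)] dt) dy`
  (absolute convergence from `‖K(σ,·)‖ ≤ Env_σ ∈ L^{p'}` and `|v||w| ∈ L^p`);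
* `blockFn_oseenSlice_apply_of_memLp` — **the block of a slice is the slice with the blocked
  kernel**, `Δ̇_j T_σ[v,w](x) = ∫ (Δ̇_j K(σ,·)[v(y), w(y)])(x - y) dy` (the `L^p × L^∞` companion of
  `blockFn_oseenSlice_apply` of `BesovDuhamelBlocks.lean`), and `heatExtension_oseenSlice_apply` —
  **the heat flow of a slice shifts the kernel time**, `e^{hΔ} T_σ[v,w] = T_{σ+h}[v,w]`
  (the kernel semigroup law `heatExtension_oseenKernel`);
* `norm_blockFn_oseenKernel_le` — after expanding in an orthonormal basis,
  `‖Δ̇_j K(σ,·)[a,b](z)‖ ≤ ‖a‖‖b‖ ∑_{k,l} ‖Δ̇_j K(σ,·)[e_k,e_l](z)‖`;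
* `eLpNorm_blockFn_oseenSlice_le_sum` — **Young**:
  `‖Δ̇_j T_σ[v,w]‖_{L^p} ≤ (∑_{k,l} ‖Δ̇_j K(σ,·)[e_k,e_l]‖_{L¹}) ‖v‖_{L^p} ‖w‖_{L^∞}`;
* `exists_eLpNorm_blockFn_oseenSlice_le` — with the low-frequency bound of
  `OseenKernelBlocks.lean` (`∝ 2^{jθ}σ^{(θ-1)/2}`, `0 ≤ θ < 1`) and the plain bound
  `‖Δ̇_j f‖₁ ≤ ‖K₀‖₁‖f‖₁`, `‖K(σ,·)[a,b]‖₁ ≤ Cσ^{-1/2}‖a‖‖b‖`: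
  `‖Δ̇_j T_σ[v,w]‖_{L^p} ≤ C min(2^{jθ}σ^{(θ-1)/2}, σ^{-1/2}) ‖v‖_{L^p}‖w‖_{L^∞}`
  (GKP 2016, App. B, "standard estimates for the linear Stokes kernel"; the exponentially small
  high-frequency bound is not needed for the critical theory because `s_p = -1 + 3/p < 0`).

## References

* H. Bahouri, J.-Y. Chemin, R. Danchin, *Fourier Analysis and Nonlinear PDE* (2011), §2.1,
  Lemma 2.4, Thm. 5.40. [BahouriCheminDanchin2011]
* I. Gallagher, G. S. Koch, F. Planchon, Comm. Math. Phys. 343 (2016) = arXiv:1407.4156, App. B.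
  [GKP2016]
* H. Koch, D. Tataru, Adv. Math. 157 (2001), §2 (8), (14). [KochTataruAdvMath2001]
-/

noncomputable section

open MeasureTheory Set Function Filter TopologicalSpace
open _root_.Topology
open scoped ENNReal NNReal RealInnerProductSpace

namespace Literature.Analysis.FluidPDE

open FunctionSpaces (blockFn blockKernel)

variable {E : Type*} [NormedAddCommGroup E] [InnerProductSpace ℝ E] [FiniteDimensional ℝ E]
  [MeasurableSpace E] [BorelSpace E]

/-! ### The absolute size of a slice integrand in `L¹(dy)` -/

section SliceSize

/-- **Hölder size of the slice integrand**: if `‖K(τ,z)[p,q]‖ ≤ Env_τ(z)‖p‖‖q‖`, then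
`∫ ‖K(σ, x - y)[v(y), w(y)]‖ dy ≤ ‖Env_σ‖_{L^p} ‖|v||w|‖_{L^q}` for conjugate `p, q`, uniformly in
`x`. [folklore] -/
theorem lintegral_enorm_oseenKernel_slice_le_holder {C : ℝ} (hC : 0 ≤ C)
    (hK : ∀ {τ : ℝ}, 0 < τ → ∀ z p q : E, ‖oseenKernel τ z p q‖ ≤
      C * (τ + ‖z‖ ^ 2) ^ (-(((Module.finrank ℝ E : ℝ) + 1) / 2)) * ‖p‖ * ‖q‖)
    {σ : ℝ} (hσ : 0 < σ) {v w : E → E} (hv : AEStronglyMeasurable v volume)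
    (hw : AEStronglyMeasurable w volume) (p q : ℝ≥0∞) [p.HolderConjugate q] (x : E) :
    ∫⁻ y, ‖oseenKernel σ (x - y) (v y) (w y)‖ₑ ≤
      eLpNorm (fun z : E => C * (σ + ‖z‖ ^ 2) ^ (-(((Module.finrank ℝ E : ℝ) + 1) / 2))) p volume *
        eLpNorm (fun y => ‖v y‖ * ‖w y‖) q volume := by
  set d : ℝ := (Module.finrank ℝ E : ℝ) with hd
  set Env : E → ℝ := fun z => C * (σ + ‖z‖ ^ 2) ^ (-((d + 1) / 2)) with hEnv
  set g : E → ℝ := fun y => ‖v y‖ * ‖w y‖ with hg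
  have hEnv0 : ∀ z, 0 ≤ Env z := fun z => mul_nonneg hC (Real.rpow_nonneg (by positivity) _)
  have hEnvm : AEStronglyMeasurable Env volume :=
    (measurable_const.mul ((measurable_const.add (measurable_norm.pow_const 2)).pow
      measurable_const)).aestronglyMeasurable
  have hgm : AEStronglyMeasurable g volume := hv.norm.mul hw.norm
  have hmp : MeasurePreserving (fun y => x - y) volume volume :=
    Measure.measurePreserving_sub_left volume x
  have hEnvx : AEStronglyMeasurable (fun y => Env (x - y)) volume := hEnvm.comp_measurePreserving hmp
  have hpt : ∀ y, ‖oseenKernel σ (x - y) (v y) (w y)‖ₑ ≤ ‖Env (x - y)‖ₑ * ‖g y‖ₑ := by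
    intro y
    have h := hK hσ (x - y) (v y) (w y)
    rw [← ofReal_norm, Real.enorm_eq_ofReal (hEnv0 _),
      Real.enorm_eq_ofReal (mul_nonneg (norm_nonneg _) (norm_nonneg _)),
      ← ENNReal.ofReal_mul (hEnv0 _)]
    refine ENNReal.ofReal_le_ofReal ?_
    calc ‖oseenKernel σ (x - y) (v y) (w y)‖
        ≤ C * (σ + ‖x - y‖ ^ 2) ^ (-((d + 1) / 2)) * ‖v y‖ * ‖w y‖ := h
      _ = Env (x - y) * g y := by rw [hEnv, hg]; ring
  calc ∫⁻ y, ‖oseenKernel σ (x - y) (v y) (w y)‖ₑ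
      ≤ ∫⁻ y, ‖Env (x - y)‖ₑ * ‖g y‖ₑ := lintegral_mono hpt
    _ = eLpNorm ((fun y => Env (x - y)) • g) 1 volume := by
        rw [eLpNorm_one_eq_lintegral_enorm]
        simp_rw [Pi.smul_apply', enorm_smul]
    _ ≤ eLpNorm (fun y => Env (x - y)) p volume * eLpNorm g q volume :=
        eLpNorm_smul_le_mul_eLpNorm hgm hEnvx
    _ = eLpNorm Env p volume * eLpNorm g q volume := by
        rw [show (fun y => Env (x - y)) = Env ∘ (fun y => x - y) from rfl,
          eLpNorm_comp_measurePreserving hEnvm hmp]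

end SliceSize

/-! ### Fubini: an `L¹` kernel against a slice -/

section Fubini

/-- **Fubini for an integrable continuous kernel against a slice**: for `k ∈ L¹ ∩ C(E)`, `σ > 0`,
`v ∈ L^p` measurable (`1 < p`) and `w` measurable and essentially bounded,
`∫ k(t) • ∫ K(σ, x-t-y)[v(y), w(y)] dy dt = ∫ ∫ k(t) • K(σ, x-y-t)[v(y), w(y)] dt dy`; the double
integral converges absolutely because `∫‖K(σ, z-y)[v(y),w(y)]‖dy ≤ ‖Env_σ‖_{p'}‖|v||w|‖_p` uniformly
in `z`. [folklore] -/
theorem integral_smul_integral_oseenKernel_comm {k : E → ℝ} (hkc : Continuous k)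
    (hki : Integrable k volume) {σ : ℝ} (hσ : 0 < σ) {p : ℝ≥0∞} (hp1 : 1 < p) {v w : E → E}
    (hvm : Measurable v) (hwm : Measurable w) (hv : MemLp v p volume)
    (hw : eLpNorm w ∞ volume < ∞) (x : E) :
    ∫ t, k t • ∫ y, oseenKernel σ (x - t - y) (v y) (w y) =
      ∫ y, ∫ t, k t • oseenKernel σ (x - y - t) (v y) (w y) := by
  -- exponents and the envelope
  have hp1' : 1 ≤ p := hp1.le
  set p' : ℝ≥0∞ := ENNReal.conjExponent p with hp'
  haveI hHC : p.HolderConjugate p' := .conjExponent hp1'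
  haveI hHC' : p'.HolderConjugate p := inferInstance
  have hp'1 : 1 ≤ p' := ENNReal.HolderConjugate.one_le p' p
  have hp'top : p' ≠ ∞ := by
    intro h
    have h1 : p⁻¹ + p'⁻¹ = 1 := ENNReal.HolderConjugate.inv_add_inv_eq_one p p'
    rw [h, ENNReal.inv_top, add_zero, ENNReal.inv_eq_one] at h1
    exact absurd h1 hp1.ne'
  obtain ⟨C, hC, hK⟩ := exists_norm_oseenKernel_le (E := E)
  obtain ⟨B, hB0, hB⟩ := exists_eLpNorm_oseenEnvelope_le (E := E) hC.le hp'1 hp'top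
  -- the product `|v| |w| ∈ L^p`
  have hwmem : MemLp w ∞ volume := ⟨hwm.aestronglyMeasurable, hw⟩
  have hg : MemLp (fun y => ‖v y‖ * ‖w y‖) p volume := by
    have h := MemLp.mul' (p := ∞) (q := p) (r := p) hv.norm hwmem.norm
    simpa only [mul_comm] using h
  -- a uniform bound for the absolute slices
  set M : ℝ≥0∞ := eLpNorm (fun z : E => C * (σ + ‖z‖ ^ 2) ^
      (-(((Module.finrank ℝ E : ℝ) + 1) / 2))) p' volume *
    eLpNorm (fun y => ‖v y‖ * ‖w y‖) p volume with hM
  have hMtop : M < ∞ :=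
    ENNReal.mul_lt_top ((hB σ hσ).trans_lt ENNReal.ofReal_lt_top) hg.eLpNorm_lt_top
  have hslice : ∀ z : E, ∫⁻ y, ‖oseenKernel σ (z - y) (v y) (w y)‖ₑ ≤ M := fun z =>
    lintegral_enorm_oseenKernel_slice_le_holder hC.le hK hσ hv.1 hwm.aestronglyMeasurable p' p z
  -- the integrand on `E × E` and its integrability
  set F : E → E → E := fun t y => k t • oseenKernel σ (x - t - y) (v y) (w y) with hF
  have hFm : Measurable (uncurry F) :=
    (hkc.measurable.comp measurable_fst).smul
      (Measurable.oseenKernel_comp measurable_const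
        ((measurable_const.sub measurable_fst).sub measurable_snd) (hvm.comp measurable_snd)
        (hwm.comp measurable_snd))
  have hsm : ∀ z : E, AEStronglyMeasurable (fun y => oseenKernel σ (z - y) (v y) (w y)) volume :=
    fun z => (Measurable.oseenKernel_comp measurable_const (measurable_const.sub measurable_id)
      hvm hwm).aestronglyMeasurable
  have hint : Integrable (uncurry F) ((volume : Measure E).prod volume) := by
    refine (integrable_prod_iff hFm.aestronglyMeasurable).2 ⟨Eventually.of_forall fun t => ?_, ?_⟩
    · exact (KatoLp.integrable_oseenKernel_slice_Lp hσ hp1 hv hwm.aestronglyMeasurable hw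
        (x - t)).smul (k t)
    · refine (hki.norm.mul_const M.toReal).mono'
        hFm.aestronglyMeasurable.norm.integral_prod_right' (Eventually.of_forall fun t => ?_)
      rw [Real.norm_of_nonneg (integral_nonneg fun y => norm_nonneg _)]
      have h1 : ∫ y, ‖uncurry F (t, y)‖ = ‖k t‖ * ∫ y, ‖oseenKernel σ (x - t - y) (v y) (w y)‖ := by
        rw [← integral_const_mul]
        refine integral_congr_ae (Eventually.of_forall fun y => ?_)
        simp only [uncurry, hF, norm_smul]
      rw [h1]
      refine mul_le_mul_of_nonneg_left ?_ (norm_nonneg _)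
      rw [integral_norm_eq_lintegral_enorm (hsm (x - t))]
      exact ENNReal.toReal_mono hMtop.ne (hslice (x - t))
  calc ∫ t, k t • ∫ y, oseenKernel σ (x - t - y) (v y) (w y) = ∫ t, ∫ y, F t y := by
        refine integral_congr_ae (Eventually.of_forall fun t => ?_)
        exact (integral_smul _ _).symm
    _ = ∫ y, ∫ t, F t y := integral_integral_swap hint
    _ = ∫ y, ∫ t, k t • oseenKernel σ (x - y - t) (v y) (w y) := by
        refine integral_congr_ae (Eventually.of_forall fun y =>
          integral_congr_ae (Eventually.of_forall fun t => ?_))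
        simp only [hF, sub_right_comm x t y]

/-- **The block of a slice is the slice with the blocked kernel**:
`Δ̇_j T_σ[v,w](x) = ∫ (Δ̇_j K(σ,·)[v(y), w(y)])(x - y) dy`. [cite: GKP2016, App. B] -/
theorem blockFn_oseenSlice_apply_of_memLp {σ : ℝ} (hσ : 0 < σ) {p : ℝ≥0∞} (hp1 : 1 < p) {v w : E → E}
    (hvm : Measurable v) (hwm : Measurable w) (hv : MemLp v p volume)
    (hw : eLpNorm w ∞ volume < ∞) (j : ℤ) (x : E) :
    blockFn j (fun x => ∫ y, oseenKernel σ (x - y) (v y) (w y)) x =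
      ∫ y, blockFn j (fun z => oseenKernel σ z (v y) (w y)) (x - y) := by
  rw [FunctionSpaces.blockFn_apply,
    integral_smul_integral_oseenKernel_comm (FunctionSpaces.continuous_blockKernel j)
      (FunctionSpaces.integrable_blockKernel j) hσ hp1 hvm hwm hv hw x]
  refine integral_congr_ae (Eventually.of_forall fun y => ?_)
  simp only [FunctionSpaces.blockFn_apply]

/-- **The heat flow of a slice shifts the kernel time**: `e^{hΔ} T_σ[v,w](x) = T_{σ+h}[v,w](x)`
for every `x` (the kernel semigroup law `e^{hΔ}K(σ) = K(σ+h)` of `OseenKernelSemigroup.lean` under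
the integral sign). [cite: KochTataruAdvMath2001, §2 (8)] -/
theorem heatExtension_oseenSlice_apply {σ h : ℝ} (hσ : 0 < σ) (hh : 0 < h) {p : ℝ≥0∞}
    (hp1 : 1 < p) {v w : E → E} (hvm : Measurable v) (hwm : Measurable w)
    (hv : MemLp v p volume) (hw : eLpNorm w ∞ volume < ∞) (x : E) :
    UnboundedOperators.heatExtension (fun x => ∫ y, oseenKernel σ (x - y) (v y) (w y)) h x =
      ∫ y, oseenKernel (σ + h) (x - y) (v y) (w y) := by
  rw [UnboundedOperators.heatExtension_apply,
    integral_smul_integral_oseenKernel_comm (UnboundedOperators.continuous_heatKernel h)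
      (UnboundedOperators.integrable_heatKernel_holds (E := E) hh) hσ hp1 hvm hwm hv hw x]
  refine integral_congr_ae (Eventually.of_forall fun y => ?_)
  exact integral_heatKernel_smul_oseenKernel_sub hσ hh (v y) (w y) (x - y)

end Fubini

/-! ### Domination of the blocked kernel after expansion in an orthonormal basis -/

section Domination

/-- **The blocked kernel is bilinear in the vectors**: expanding `a`, `b` in an orthonormal basis
`e`, `Δ̇_j K(σ,·)[a,b] = ∑_{k,l} ⟪e_k,a⟫⟪e_l,b⟫ Δ̇_j K(σ,·)[e_k,e_l]`. [folklore] -/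
theorem blockFn_oseenKernel_eq_sum {ι : Type*} [Fintype ι] (e : OrthonormalBasis ι ℝ E) (j : ℤ)
    {σ : ℝ} (hσ : 0 < σ) (a b z : E) :
    blockFn j (fun z => oseenKernel σ z a b) z =
      ∑ kl : ι × ι, (⟪e kl.1, a⟫ * ⟪e kl.2, b⟫) •
        blockFn j (fun z => oseenKernel σ z (e kl.1) (e kl.2)) z := by
  haveI h11 : Fact ((1 : ℝ≥0∞) ≤ 1) := ⟨le_rfl⟩
  have hexp : (fun z => oseenKernel σ z a b) =
      ∑ kl : ι × ι, (⟪e kl.1, a⟫ * ⟪e kl.2, b⟫) • fun z => oseenKernel σ z (e kl.1) (e kl.2) := by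
    funext z
    simp only [Finset.sum_apply, Pi.smul_apply]
    rw [oseenKernel_eq_sum_orthonormalBasis e σ z a b, ← Fintype.sum_prod_type']
  have hmem : ∀ kl : ι × ι, MemLp ((⟪e kl.1, a⟫ * ⟪e kl.2, b⟫) •
      fun z => oseenKernel σ z (e kl.1) (e kl.2)) 1 volume := fun kl =>
    (memLp_one_iff_integrable.2 (integrable_oseenKernel_left_slice hσ _ _)).const_smul _
  rw [hexp, FunctionSpaces.blockFn_sum j _ (fun kl _ => hmem kl), Finset.sum_apply]
  refine Finset.sum_congr rfl fun kl _ => ?_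
  rw [FunctionSpaces.blockFn_smul, Pi.smul_apply]

/-- **Domination of the blocked kernel**:
`‖Δ̇_j K(σ,·)[a,b](z)‖ ≤ ‖a‖‖b‖ ∑_{k,l} ‖Δ̇_j K(σ,·)[e_k,e_l](z)‖`. [folklore] -/
theorem norm_blockFn_oseenKernel_le {ι : Type*} [Fintype ι] (e : OrthonormalBasis ι ℝ E) (j : ℤ)
    {σ : ℝ} (hσ : 0 < σ) (a b z : E) :
    ‖blockFn j (fun z => oseenKernel σ z a b) z‖ ≤
      ‖a‖ * ‖b‖ * ∑ kl : ι × ι, ‖blockFn j (fun z => oseenKernel σ z (e kl.1) (e kl.2)) z‖ := by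
  rw [blockFn_oseenKernel_eq_sum e j hσ a b z, Finset.mul_sum]
  refine (norm_sum_le _ _).trans (Finset.sum_le_sum fun kl _ => ?_)
  rw [norm_smul]
  refine mul_le_mul_of_nonneg_right ?_ (norm_nonneg _)
  rw [norm_mul]
  have h1 : ‖⟪e kl.1, a⟫‖ ≤ ‖a‖ := by
    refine (norm_inner_le_norm _ _).trans ?_
    rw [e.norm_eq_one, one_mul]
  have h2 : ‖⟪e kl.2, b⟫‖ ≤ ‖b‖ := by
    refine (norm_inner_le_norm _ _).trans ?_
    rw [e.norm_eq_one, one_mul]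
  exact mul_le_mul h1 h2 (norm_nonneg _) (norm_nonneg _)

end Domination

/-! ### Young: the `L^p` size of the blocks of a slice -/

section Young

/-- **Young for the blocks of a slice**: with an orthonormal basis `e`,
`‖Δ̇_j T_σ[v,w]‖_{L^p} ≤ (∑_{k,l} ‖Δ̇_j K(σ,·)[e_k,e_l]‖_{L¹}) ‖v‖_{L^p} ‖w‖_{L^∞}`, `1 < p`.
[cite: GKP2016, App. B] -/
theorem eLpNorm_blockFn_oseenSlice_le_sum {ι : Type*} [Fintype ι] (e : OrthonormalBasis ι ℝ E)
    {σ : ℝ} (hσ : 0 < σ) {p : ℝ≥0∞} (hp1 : 1 < p) {v w : E → E} (hvm : Measurable v)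
    (hwm : Measurable w) (hv : MemLp v p volume) (hw : eLpNorm w ∞ volume < ∞) (j : ℤ) :
    eLpNorm (blockFn j (fun x => ∫ y, oseenKernel σ (x - y) (v y) (w y))) p volume ≤
      (∑ kl : ι × ι, ∫⁻ z, ‖blockFn j (fun z => oseenKernel σ z (e kl.1) (e kl.2)) z‖ₑ) *
        (eLpNorm v p volume * eLpNorm w ∞ volume) := by
  -- the dominating kernel and the data size
  set 𝔎 : E → ℝ := fun z => ∑ kl : ι × ι, ‖blockFn j (fun z => oseenKernel σ z (e kl.1) (e kl.2)) z‖
    with h𝔎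
  set g : E → ℝ := fun y => ‖v y‖ * ‖w y‖ with hg
  have h𝔎0 : ∀ z, 0 ≤ 𝔎 z := fun z => Finset.sum_nonneg fun kl _ => norm_nonneg _
  have hbm : ∀ kl : ι × ι, AEStronglyMeasurable
      (blockFn j (fun z => oseenKernel σ z (e kl.1) (e kl.2))) volume := fun kl =>
    FunctionSpaces.aestronglyMeasurable_blockFn j
      (measurable_oseenKernel_left σ _ _).aestronglyMeasurable
  have h𝔎m : AEStronglyMeasurable 𝔎 volume :=
    Finset.aestronglyMeasurable_fun_sum _ fun kl _ => (hbm kl).norm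
  have hgm : AEStronglyMeasurable g volume := hv.1.norm.mul hwm.aestronglyMeasurable.norm
  -- pointwise domination of the block of the slice
  have hdom : ∀ x, ‖blockFn j (fun x => ∫ y, oseenKernel σ (x - y) (v y) (w y)) x‖ₑ ≤
      ∫⁻ y, ‖𝔎 y‖ₑ * ‖g (x - y)‖ₑ := by
    intro x
    rw [blockFn_oseenSlice_apply_of_memLp hσ hp1 hvm hwm hv hw j x]
    have hpt : ∀ y, ‖blockFn j (fun z => oseenKernel σ z (v y) (w y)) (x - y)‖ₑ ≤
        ‖𝔎 (x - y)‖ₑ * ‖g y‖ₑ := by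
      intro y
      rw [← ofReal_norm, Real.enorm_eq_ofReal (h𝔎0 _),
        Real.enorm_eq_ofReal (mul_nonneg (norm_nonneg _) (norm_nonneg _)),
        ← ENNReal.ofReal_mul (h𝔎0 _)]
      refine ENNReal.ofReal_le_ofReal ?_
      calc ‖blockFn j (fun z => oseenKernel σ z (v y) (w y)) (x - y)‖
          ≤ ‖v y‖ * ‖w y‖ * 𝔎 (x - y) := norm_blockFn_oseenKernel_le e j hσ (v y) (w y) (x - y)
        _ = 𝔎 (x - y) * g y := by rw [hg]; ring
    calc ‖∫ y, blockFn j (fun z => oseenKernel σ z (v y) (w y)) (x - y)‖ₑ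
        ≤ ∫⁻ y, ‖blockFn j (fun z => oseenKernel σ z (v y) (w y)) (x - y)‖ₑ :=
          enorm_integral_le_lintegral_enorm _
      _ ≤ ∫⁻ y, ‖𝔎 (x - y)‖ₑ * ‖g y‖ₑ := lintegral_mono hpt
      _ = ∫⁻ y, ‖𝔎 y‖ₑ * ‖g (x - y)‖ₑ := by
          have h := lintegral_sub_left_eq_self (μ := (volume : Measure E))
            (fun y => ‖𝔎 y‖ₑ * ‖g (x - y)‖ₑ) x
          simp only [sub_sub_cancel] at h
          exact h
  -- Young
  have hY := eLpNorm_le_lintegral_mul_eLpNorm_of_dominated h𝔎m hgm hdom hp1.le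
  -- the `L¹` size of the dominating kernel and the `L^p` size of the data
  have h𝔎1 : ∫⁻ y, ‖𝔎 y‖ₑ =
      ∑ kl : ι × ι, ∫⁻ z, ‖blockFn j (fun z => oseenKernel σ z (e kl.1) (e kl.2)) z‖ₑ := by
    have hpt : ∀ y, ‖𝔎 y‖ₑ =
        ∑ kl : ι × ι, ‖blockFn j (fun z => oseenKernel σ z (e kl.1) (e kl.2)) y‖ₑ := by
      intro y
      rw [Real.enorm_eq_ofReal (h𝔎0 y), h𝔎, ENNReal.ofReal_sum_of_nonneg fun kl _ => norm_nonneg _]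
      exact Finset.sum_congr rfl fun kl _ => ofReal_norm _
    simp_rw [hpt]
    exact lintegral_finsetSum' _ fun kl _ => (hbm kl).enorm
  have hgp : eLpNorm g p volume ≤ eLpNorm v p volume * eLpNorm w ∞ volume :=
    eLpNorm_norm_mul_norm_le hv.1 hwm.aestronglyMeasurable p ∞ p
  rw [h𝔎1] at hY
  exact hY.trans (mul_le_mul' le_rfl hgp)

/-- **The `L^p` size of the blocks of a slice** (GKP 2016, App. B, "standard estimates for the
linear Stokes kernel"): for `0 ≤ θ < 1` and `1 < p` there is `C` with
`‖Δ̇_j T_σ[v,w]‖_{L^p} ≤ C min(2^{jθ} σ^{(θ-1)/2}, σ^{-1/2}) ‖v‖_{L^p} ‖w‖_{L^∞}` for all `j ∈ ℤ`,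
`σ > 0`, measurable `v ∈ L^p` and measurable essentially bounded `w`: the low-frequency bound is the
vanishing-mean gain `exists_lintegral_enorm_oseenKernelBlock_le_low` of the blocked kernel, the
other one is `‖Δ̇_j f‖_{L¹} ≤ ‖K₀‖_{L¹}‖f‖_{L¹}` with `‖K(σ,·)[a,b]‖_{L¹} ≤ Cσ^{-1/2}‖a‖‖b‖`
(Koch–Tataru's (14)). [cite: GKP2016, App. B] -/
theorem exists_eLpNorm_blockFn_oseenSlice_le {θ : ℝ} (hθ0 : 0 ≤ θ) (hθ1 : θ < 1) {p : ℝ≥0∞}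
    (hp1 : 1 < p) :
    ∃ C : ℝ, 0 ≤ C ∧ ∀ (j : ℤ) {σ : ℝ}, 0 < σ → ∀ {v w : E → E}, Measurable v → Measurable w →
      MemLp v p volume → eLpNorm w ∞ volume < ∞ →
        eLpNorm (blockFn j (fun x => ∫ y, oseenKernel σ (x - y) (v y) (w y))) p volume ≤
          ENNReal.ofReal (C * min ((2 : ℝ) ^ ((j : ℝ) * θ) * σ ^ ((θ - 1) / 2))
            (σ ^ (-(1 / 2 : ℝ)))) * (eLpNorm v p volume * eLpNorm w ∞ volume) := by
  set e := stdOrthonormalBasis ℝ E with he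
  set N : ℕ := Fintype.card (Fin (Module.finrank ℝ E) × Fin (Module.finrank ℝ E)) with hN
  obtain ⟨CL, hCL, hL⟩ := exists_lintegral_enorm_oseenKernelBlock_le_low (E := E) hθ0 hθ1
  obtain ⟨CK, hCK, hK⟩ := exists_lintegral_enorm_oseenKernel_le (E := E)
  have hK1top := lintegral_enorm_blockKernel_lt_top (E := E) 0
  set K₁ : ℝ := (∫⁻ y, ‖blockKernel E 0 y‖ₑ).toReal with hK₁
  have hK₁0 : 0 ≤ K₁ := ENNReal.toReal_nonneg
  have hK₁eq : ENNReal.ofReal K₁ = ∫⁻ y, ‖blockKernel E 0 y‖ₑ := ENNReal.ofReal_toReal hK1top.ne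
  set C₀ : ℝ := max CL (K₁ * CK) with hC₀
  have hC₀0 : 0 ≤ C₀ := le_max_of_le_left hCL
  refine ⟨N * C₀, by positivity, fun j {σ} hσ {v w} hvm hwm hv hw => ?_⟩
  haveI h11 : Fact ((1 : ℝ≥0∞) ≤ 1) := ⟨le_rfl⟩
  -- each term of the kernel sum obeys both bounds
  set L : ℝ := (2 : ℝ) ^ ((j : ℝ) * θ) * σ ^ ((θ - 1) / 2) with hLdef
  set H : ℝ := σ ^ (-(1 / 2 : ℝ)) with hHdef
  have hL0 : 0 ≤ L := by positivity
  have hH0 : 0 ≤ H := Real.rpow_nonneg hσ.le _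
  have hterm : ∀ kl : Fin (Module.finrank ℝ E) × Fin (Module.finrank ℝ E),
      ∫⁻ z, ‖blockFn j (fun z => oseenKernel σ z (e kl.1) (e kl.2)) z‖ₑ ≤
        ENNReal.ofReal (C₀ * min L H) := by
    intro kl
    have hlow : ∫⁻ z, ‖blockFn j (fun z => oseenKernel σ z (e kl.1) (e kl.2)) z‖ₑ ≤
        ENNReal.ofReal (CL * L) := by
      refine (hL j hσ (e kl.1) (e kl.2)).trans (le_of_eq ?_)
      rw [e.norm_eq_one, e.norm_eq_one, mul_one, mul_one, hLdef, ← mul_assoc]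
    have hhigh : ∫⁻ z, ‖blockFn j (fun z => oseenKernel σ z (e kl.1) (e kl.2)) z‖ₑ ≤
        ENNReal.ofReal (K₁ * CK * H) := by
      have hf : AEStronglyMeasurable (fun z => oseenKernel σ z (e kl.1) (e kl.2)) volume :=
        (measurable_oseenKernel_left σ _ _).aestronglyMeasurable
      have h1 := FunctionSpaces.eLpNorm_blockFn_le j hf (p := 1) le_rfl
      rw [eLpNorm_one_eq_lintegral_enorm, eLpNorm_one_eq_lintegral_enorm,
        lintegral_enorm_blockKernel j] at h1
      refine h1.trans ?_
      have h2 := (hK hσ (e kl.1) (e kl.2)).2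
      rw [e.enorm_eq_one, e.enorm_eq_one, mul_one, mul_one] at h2
      calc (∫⁻ y, ‖blockKernel E 0 y‖ₑ) * ∫⁻ z, ‖oseenKernel σ z (e kl.1) (e kl.2)‖ₑ
          ≤ ENNReal.ofReal K₁ * ENNReal.ofReal (CK * σ ^ (-(1 / 2 : ℝ))) := by
            rw [hK₁eq]; gcongr
        _ = ENNReal.ofReal (K₁ * CK * H) := by
            rw [← ENNReal.ofReal_mul hK₁0, hHdef, mul_assoc]
    rcases le_total L H with hLH | hHL
    · rw [min_eq_left hLH]
      refine hlow.trans (ENNReal.ofReal_le_ofReal ?_)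
      exact mul_le_mul_of_nonneg_right (le_max_left _ _) hL0
    · rw [min_eq_right hHL]
      refine hhigh.trans (ENNReal.ofReal_le_ofReal ?_)
      exact mul_le_mul_of_nonneg_right (le_max_right _ _) hH0
  have hsum : (∑ kl : Fin (Module.finrank ℝ E) × Fin (Module.finrank ℝ E),
      ∫⁻ z, ‖blockFn j (fun z => oseenKernel σ z (e kl.1) (e kl.2)) z‖ₑ) ≤
      ENNReal.ofReal (N * C₀ * min L H) := by
    refine (Finset.sum_le_sum fun kl _ => hterm kl).trans (le_of_eq ?_)
    rw [Finset.sum_const, Finset.card_univ, ← hN, nsmul_eq_mul, mul_assoc (N : ℝ),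
      ENNReal.ofReal_mul (Nat.cast_nonneg N), ENNReal.ofReal_natCast]
  exact (eLpNorm_blockFn_oseenSlice_le_sum e hσ hp1 hvm hwm hv hw j).trans
    (mul_le_mul' hsum le_rfl)

end Young

end Literature.Analysis.FluidPDE

end
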